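import Literature.Dynamics.Hyperbolic.CLPHyperbolicSetIterate

/-!
# Pseudo-orbits in a Chow–Lin–Palmer hyperbolic set follow block orbits; interpolation inside blocks

Topic `Literature/Dynamics/Hyperbolic`.  The elementary (non-hyperbolic) half of Pilyugin's reduction of shadowing
for `ψ` to shadowing for the block map `Ψ = ψ^ν` (LNM 1706, §1.1, Lemma 1.1.3 and formula (1.4)), for a `C¹` map `ψ`
near a set `T` carrying a Chow–Lin–Palmer structure `IsCLPHyperbolicSet ψ T P Q N λ Δ`
(`ChowLinPalmerShadowing.lean`; only conditions (1) and (5) are used here):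

* §A — CENTRE-FORM CALCULUS NEAR `T`, restating the displacement-form estimates of `CLPHyperbolicSetIterate.lean`
  around a centre `a ∈ T`: the one-step Lipschitz estimate (`norm_sub_le_of_mem`), iterates of a nearby point follow
  the iterates of `a` (`norm_iterate_sub_iterate_le_of_mem`), a uniform modulus of `x ↦ D(ψⁿ)(x)` at the points of
  `T` (`fderiv_iterate_modulus`), the mean value remainder for `ψⁿ` around a point (`norm_iterate_sub_sub_fderiv_le`),
  and **Lemma 1.1.3 (1)**: a `d`-pseudo-orbit `y ⊆ T` satisfies `‖ψʲ(y_k) - y_{k+j}‖ ≤ j Mʲ d` for `j ≤ n` as long as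
  `n Mⁿ d ≤ Δ` (`norm_iterate_sub_pseudoOrbit_le`; cruder constant `j Mʲ` in place of `1 + M + ⋯ + M^{j-1}`).
* INTERPOLATION (formula (1.4)): an orbit `zs` of `ψ^ν` extends to the orbit `k ↦ ψ^{k mod ν}(zs_{⌊k/ν⌋})` of `ψ`
  (`isOrbit_interpolate`, `interpolate_apply`), and an orbit of `ψ` is determined by its values at the block starts
  (`IsOrbit.apply_block`).

Everything is proved.  Consumed by `ChowLinPalmerShadowingProofs.lean`.

## References

* S. Yu. Pilyugin, *Shadowing in Dynamical Systems*, LNM 1706, Springer (1999), §1.1, Lemma 1.1.3, (1.4). [Pilyugin1999]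
-/

noncomputable section

open Set Function Metric
open scoped Topology

namespace Literature.Dynamics.Hyperbolic

variable {E : Type*} [NormedAddCommGroup E] [NormedSpace ℝ E]

namespace IsCLPHyperbolicSet

variable {ψ : E → E} {T : Set E} {P Q : E → E →L[ℝ] E} {N lam Δ : ℝ}

/-! ## §A Calculus of `ψ` and its iterates near `T` (condition (5)), centre form

The displacement-form estimates of `CLPHyperbolicSetIterate.lean` (points `x + v`, `‖v‖ ≤ Δ/K^j`) restated around a
centre `a ∈ T` (points `b` with `K^n ‖b - a‖ ≤ Δ`), which is the form the block reduction consumes, plus the mean value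
remainder for `ψⁿ` and Pilyugin's Lemma 1.1.3 (1) for pseudo-orbits. -/

/-- ONE-STEP LIPSCHITZ ESTIMATE near a point of `T` (centre form of
`IsCLPHyperbolicSet.norm_apply_sub_apply_le`): if `‖Dψ‖ ≤ M` on the closed `Δ`-neighbourhood of `T`, then
`‖ψ b - ψ c‖ ≤ M ‖b - c‖` for `b, c` in the closed `Δ`-ball around `a ∈ T`. [folklore] -/
theorem norm_sub_le_of_mem (h : IsCLPHyperbolicSet ψ T P Q N lam Δ) {M : ℝ}
    (hM : ∀ y ∈ cthickening Δ T, ‖fderiv ℝ ψ y‖ ≤ M) {a b c : E} (ha : a ∈ T)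
    (hb : ‖b - a‖ ≤ Δ) (hc : ‖c - a‖ ≤ Δ) : ‖ψ b - ψ c‖ ≤ M * ‖b - c‖ := by
  have := h.norm_apply_sub_apply_le hM ha hb hc
  rwa [add_sub_cancel, add_sub_cancel, sub_sub_sub_cancel_right] at this

/-- ITERATES OF NEARBY POINTS (centre form of `IsCLPHyperbolicSet.norm_iterate_sub_le`): for `a ∈ T`, `M ≥ 1`
bounding `‖Dψ‖` near `T` and `M^n ‖b - a‖ ≤ Δ`, `‖ψ^j b - ψ^j a‖ ≤ M^j ‖b - a‖` for `j ≤ n`. [folklore] -/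
theorem norm_iterate_sub_iterate_le_of_mem (h : IsCLPHyperbolicSet ψ T P Q N lam Δ) {M : ℝ}
    (hM : ∀ y ∈ cthickening Δ T, ‖fderiv ℝ ψ y‖ ≤ M) (hM1 : 1 ≤ M) {a b : E} (ha : a ∈ T) {n : ℕ}
    (hn : M ^ n * ‖b - a‖ ≤ Δ) : ∀ j, j ≤ n → ‖ψ^[j] b - ψ^[j] a‖ ≤ M ^ j * ‖b - a‖ := by
  intro j hj
  have hMn : 0 < M ^ n := pow_pos (zero_lt_one.trans_le hM1) n
  have hv : ‖b - a‖ ≤ Δ / M ^ n := by rw [le_div_iff₀ hMn, mul_comm]; exact hn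
  have := (h.norm_iterate_sub_le hM hM1 ha hj hv).1
  rwa [add_sub_cancel] at this

/-- UNIFORM MODULUS OF `D(ψ^n)` AT `T` (centre form of `IsCLPHyperbolicSet.exists_modulus_fderiv_iterate`): for every
`n` and `ε > 0` there is `δ > 0` with `M^n δ ≤ Δ` such that `‖D(ψ^n)(b) - D(ψ^n)(a)‖ ≤ ε` whenever `a ∈ T` and
`‖b - a‖ ≤ δ`. [folklore] -/
theorem fderiv_iterate_modulus (h : IsCLPHyperbolicSet ψ T P Q N lam Δ) {M : ℝ}
    (hM : ∀ y ∈ cthickening Δ T, ‖fderiv ℝ ψ y‖ ≤ M) (hM1 : 1 ≤ M) (n : ℕ) {ε : ℝ} (hε : 0 < ε) :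
    ∃ δ : ℝ, 0 < δ ∧ M ^ n * δ ≤ Δ ∧
      ∀ a ∈ T, ∀ b : E, ‖b - a‖ ≤ δ → ‖fderiv ℝ (ψ^[n]) b - fderiv ℝ (ψ^[n]) a‖ ≤ ε := by
  have hMn : 0 < M ^ n := pow_pos (zero_lt_one.trans_le hM1) n
  obtain ⟨ρ, hρ, hmod⟩ := h.exists_modulus_fderiv_iterate hM hM1 n n le_rfl ε hε
  refine ⟨min ρ (Δ / M ^ n), lt_min hρ (div_pos h.Δ_pos hMn), ?_, fun a ha b hb => ?_⟩
  · calc M ^ n * min ρ (Δ / M ^ n) ≤ M ^ n * (Δ / M ^ n) :=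
          mul_le_mul_of_nonneg_left (min_le_right _ _) hMn.le
      _ = Δ := mul_div_cancel₀ _ hMn.ne'
  · have hv : ‖b - a‖ ≤ Δ / M ^ n := hb.trans (min_le_right _ _)
    have h0 : ‖(0 : E)‖ ≤ Δ / M ^ n := by rw [norm_zero]; exact div_nonneg h.Δ_pos.le hMn.le
    have := hmod a ha (b - a) 0 hv h0 (by rw [sub_zero]; exact hb.trans (min_le_left _ _))
    rwa [add_sub_cancel, add_zero] at this

/-- MEAN VALUE REMAINDER for an iterate around a point: if `‖D(ψ^n)(b) - D(ψ^n)(a)‖ ≤ κ` for `‖b - a‖ ≤ r`, then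
`‖ψ^n(a+v) - ψ^n(a+v') - D(ψ^n)(a)(v - v')‖ ≤ κ ‖v - v'‖` for `‖v‖, ‖v'‖ ≤ r`. [folklore] -/
theorem norm_iterate_sub_sub_fderiv_le (h : IsCLPHyperbolicSet ψ T P Q N lam Δ) (n : ℕ) {a : E}
    {r κ : ℝ} (hmod : ∀ b, ‖b - a‖ ≤ r → ‖fderiv ℝ (ψ^[n]) b - fderiv ℝ (ψ^[n]) a‖ ≤ κ) {v v' : E}
    (hv : ‖v‖ ≤ r) (hv' : ‖v'‖ ≤ r) :
    ‖ψ^[n] (a + v) - ψ^[n] (a + v') - fderiv ℝ (ψ^[n]) a (v - v')‖ ≤ κ * ‖v - v'‖ := by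
  have hdiff : ∀ w ∈ closedBall a r, DifferentiableAt ℝ (ψ^[n]) w := fun w _ =>
    h.differentiable_iterate n w
  have hbound : ∀ w ∈ closedBall a r, ‖fderiv ℝ (ψ^[n]) w - fderiv ℝ (ψ^[n]) a‖ ≤ κ := fun w hw =>
    hmod w (mem_closedBall_iff_norm.1 hw)
  have hx : a + v' ∈ closedBall a r := mem_closedBall_iff_norm.2 (by simpa using hv')
  have hy : a + v ∈ closedBall a r := mem_closedBall_iff_norm.2 (by simpa using hv)
  have := (convex_closedBall a r).norm_image_sub_le_of_norm_fderiv_le' hdiff hbound hx hy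
  simpa only [add_sub_add_left_eq_sub] using this

/-- PSEUDO-ORBITS FOLLOW TRUE ORBIT SEGMENTS (Pilyugin's Lemma 1.1.3 in this setting): for a `d`-pseudo-orbit
`y ⊆ T` and `n M^n d ≤ Δ`, `‖ψ^j(y_k) - y_{k+j}‖ ≤ j M^j d` for `j ≤ n`. [cite: Pilyugin1999, Lemma 1.1.3 (variant)] -/
theorem norm_iterate_sub_pseudoOrbit_le (h : IsCLPHyperbolicSet ψ T P Q N lam Δ) {M : ℝ}
    (hM : ∀ y ∈ cthickening Δ T, ‖fderiv ℝ ψ y‖ ≤ M) (hM1 : 1 ≤ M) {y : ℤ → E} {d : ℝ}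
    (hyT : ∀ k, y k ∈ T) (hy : IsPseudoOrbit ψ d y) (hd : 0 ≤ d) {n : ℕ} (hn : n * M ^ n * d ≤ Δ) :
    ∀ j, j ≤ n → ∀ k : ℤ, ‖ψ^[j] (y k) - y (k + j)‖ ≤ j * M ^ j * d := by
  have hM0 : 0 ≤ M := zero_le_one.trans hM1
  intro j
  induction j with
  | zero => intro _ k; simp
  | succ j ih =>
    intro hj k
    have hj' : j ≤ n := (Nat.le_succ j).trans hj
    have h1 := ih hj' k
    have hmono : (j : ℝ) * M ^ j * d ≤ n * M ^ n * d := by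
      apply mul_le_mul_of_nonneg_right _ hd
      exact mul_le_mul (by exact_mod_cast hj') (pow_le_pow_right₀ hM1 hj') (pow_nonneg hM0 _)
        (Nat.cast_nonneg _)
    have hclose : ‖ψ^[j] (y k) - y (k + j)‖ ≤ Δ := h1.trans (hmono.trans hn)
    have hstep : ‖ψ (ψ^[j] (y k)) - ψ (y (k + j))‖ ≤ M * (j * M ^ j * d) :=
      (h.norm_sub_le_of_mem hM (hyT (k + j)) hclose (by simpa using h.Δ_pos.le)).trans
        (mul_le_mul_of_nonneg_left h1 hM0)
    have hpo : ‖ψ (y (k + j)) - y (k + (j + 1 : ℕ))‖ ≤ d := by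
      have := hy (k + j)
      push_cast
      rwa [← add_assoc]
    rw [Function.iterate_succ_apply']
    calc ‖ψ (ψ^[j] (y k)) - y (k + (j + 1 : ℕ))‖
        = ‖(ψ (ψ^[j] (y k)) - ψ (y (k + j))) + (ψ (y (k + j)) - y (k + (j + 1 : ℕ)))‖ := by
          rw [sub_add_sub_cancel]
      _ ≤ M * (j * M ^ j * d) + d := (norm_add_le _ _).trans (add_le_add hstep hpo)
      _ ≤ M * (j * M ^ j * d) + M ^ (j + 1) * d :=
          add_le_add le_rfl (le_mul_of_one_le_left hd (one_le_pow₀ hM1))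
      _ = ((j + 1 : ℕ) : ℝ) * M ^ (j + 1) * d := by push_cast; ring

end IsCLPHyperbolicSet

/-! ## Interpolation inside the blocks (Pilyugin's formula (1.4)) -/

section Interpolation

variable {ψ : E → E}

omit [NormedAddCommGroup E] [NormedSpace ℝ E] in
/-- INTERPOLATION: an orbit `zs` of the block map `ψ^ν` (`ν ≥ 1`) extends to the orbit
`k ↦ ψ^{k mod ν}(zs_{⌊k/ν⌋})` of `ψ`. [folklore] -/
theorem isOrbit_interpolate {ν : ℕ} (hν : 1 ≤ ν) {zs : ℤ → E}
    (hz : ∀ m, ψ^[ν] (zs m) = zs (m + 1)) :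
    IsOrbit ψ (fun k => ψ^[(k % (ν : ℤ)).toNat] (zs (k / (ν : ℤ)))) := by
  intro k
  have hν0 : (0 : ℤ) < ν := by exact_mod_cast hν
  set q : ℤ := k / (ν : ℤ) with hq
  set r : ℤ := k % (ν : ℤ) with hr
  have hr0 : 0 ≤ r := Int.emod_nonneg k hν0.ne'
  have hrν : r < ν := Int.emod_lt_of_pos k hν0
  have hk : r + ν * q = k := Int.emod_add_mul_ediv k ν
  simp only
  by_cases hcase : r + 1 < ν
  · have h1 : (k + 1) / (ν : ℤ) = q ∧ (k + 1) % (ν : ℤ) = r + 1 :=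
      (Int.ediv_emod_unique hν0).2 ⟨by linarith, by linarith, hcase⟩
    rw [h1.1, h1.2]
    have e : (r + 1).toNat = r.toNat + 1 := by omega
    rw [e, Function.iterate_succ_apply']
  · have h1 : (k + 1) / (ν : ℤ) = q + 1 ∧ (k + 1) % (ν : ℤ) = 0 :=
      (Int.ediv_emod_unique hν0).2 ⟨by push Not at hcase; nlinarith [hk], le_rfl, hν0⟩
    rw [h1.1, h1.2, Int.toNat_zero, Function.iterate_zero, id_eq, ← hz q, ← hr, ← hq]
    have e : r.toNat + 1 = ν := by omega
    rw [← e, Function.iterate_succ_apply']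

omit [NormedAddCommGroup E] [NormedSpace ℝ E] in
/-- Values of the interpolated orbit: for `k = νq + j`, `0 ≤ j < ν`, it is `ψ^j(zs_q)`; packaged as the
existence of such `q`, `j` for every `k`. [folklore] -/
theorem interpolate_apply {ν : ℕ} (hν : 1 ≤ ν) (zs : ℤ → E) (k : ℤ) :
    ∃ (q : ℤ) (j : ℕ), j < ν ∧ k = q * ν + j ∧
      (fun k => ψ^[(k % (ν : ℤ)).toNat] (zs (k / (ν : ℤ)))) k = ψ^[j] (zs q) := by
  have hν0 : (0 : ℤ) < ν := by exact_mod_cast hν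
  refine ⟨k / (ν : ℤ), (k % (ν : ℤ)).toNat, ?_, ?_, rfl⟩
  · have hrν : k % (ν : ℤ) < ν := Int.emod_lt_of_pos k hν0
    have hr0 : 0 ≤ k % (ν : ℤ) := Int.emod_nonneg k hν0.ne'
    omega
  · have hr0 : 0 ≤ k % (ν : ℤ) := Int.emod_nonneg k hν0.ne'
    rw [Int.toNat_of_nonneg hr0]
    have hk := Int.emod_add_mul_ediv k ν
    linarith

omit [NormedAddCommGroup E] [NormedSpace ℝ E] in
/-- An orbit is determined by its values at the block starts: `x (q ν + j) = ψ^j (x (q ν))`. [folklore] -/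
theorem IsOrbit.apply_block {x : ℤ → E} (hx : IsOrbit ψ x) (q : ℤ) (ν j : ℕ) :
    x (q * ν + j) = ψ^[j] (x (q * ν)) :=
  hx.apply_add_natCast (q * ν) j

end Interpolation

end Literature.Dynamics.Hyperbolic

end
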